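import Summits.CriticalPhenomena.PercolationContinuityZ3.Theorems.PercNearOneGluingAdditiveGluingCSHHtwBridge
import Summits.CriticalPhenomena.PercolationContinuityZ3.Theorems.PercNearOneGluingNoHeavyLowerTailQuantitativeK6HarrisFloor
import HarnessLib

/-!
# LEMMA H with its world HARRIS terms kept: the H-part of the CSH unfolding dominates the averaged in-world Harris covariance
# `∫_{x↮Y} Cov_{w^ω}(g(𝒞_x), 1{o ↔ S ∪ {v}}) dμ`

Support file (`--supports stmt-CriticalPhenomena-4575`), prover seat `prim-rate-mine-2` (lane prim-rate, constants-miner (c); the world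
brick of BENCH rows M2-R6 / M2-R7).  No definitions, no named facts, no sorries; standard axioms.

prim-hp-8's LEMMA H (`CSH.hpart_nonneg_of_htw` / `CSH.hpart_nonneg`, paper Lemma 3.13): the "horizontal part"
`∫_{x↮Y} [Cov_{w^ω}(g(𝒞_x),1{o↔S}) − p·Cov_{w^ω}(g(𝒞_x),1{v↔S})] dμ_w(ω)` (`w^ω` = the world weights: `w` zeroed on the pairs meeting the open
cluster of the avoided set `Y`; `p = μ(o↔v | v ↮ S ∪ Y)` the GLOBAL observers' constant) is `≥ 0`, by the set four-point transfer (K6) in each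
world plus the two-source inequality (Htw).  The K6 step discards, in every world, the Harris covariance `Cov_{w^ω}(g(𝒞_x), 1{o ↔ S ∪ {v}}) ≥ 0`.
With the lane's `CSH.covTransfer_relaySet_edge_harrisFloor` (K6 with the Harris term kept) in place of `CSH.covTransfer_relaySet_edge`:

  `∫_{x↮Y} Cov_{w^ω}(g(𝒞_x), 1_{U}) dμ_w ≤ ∫_{x↮Y} [Cov_{w^ω}(g(𝒞_x),1{o↔S}) − p·Cov_{w^ω}(g(𝒞_x),1{v↔S})] dμ_w`,  `U = {o↔S} ∪ {o↔v}`
  (`CSH.worldHarris_le_hpart_of_htw`; unconditional `CSH.worldHarris_le_hpart` via `CSH.htw_world`).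

The left side is the lane's "world-Harris floor" (CANDIDATES.md M2-R7, `E_ν[Cov_{G∖C_Y}(F(C_x), 1{o↔{x,v}∖C_Y})]` at S = {x}, up to the
normalisation μ(x↮Y)); each world covariance is a Harris covariance on a product space, hence bounded below by joint pivotalities with the
size constant of `QuantHarris.sum_coinfluence_le_card_mul_cov`.
[cite: VandenbergHaggstromKahn2005, Thm. 1.1 (pp. 3–5), Thm. 1.4 (p. 7)] [cite: Gladkov2024, Thm. 3.2 (p. 4)]
-/

noncomputable section

namespace Summit.CriticalPhenomena.PercolationContinuityZ3.Theorems.CSH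

open MeasureTheory Set
open Literature.Probability.LatticeModels (prodBernoulli prodBernoulli_real_pos_of_nonempty)
open Literature.Probability.Percolation Literature.Probability.Percolation.KNPreFKG
open scoped Classical

variable {V : Type*} [Fintype V]

/-- **LEMMA H with the world Harris terms kept, given (Htw).**  Same data and hypothesis `hHtw` as `hpart_nonneg_of_htw`; conclusion:
`∫_{x↮Y} Cov_{w^ω}(g(𝒞_x), 1{o↔S ∪ {v}}) dμ ≤ ∫_{x↮Y} [Cov_{w^ω}(g,1{o↔S}) − p·Cov_{w^ω}(g,1{v↔S})] dμ`.
[cite: VandenbergHaggstromKahn2005, Thm. 1.4 (p. 7)] -/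
theorem worldHarris_le_hpart_of_htw (w : Sym2 V → unitInterval) (hw : ∀ e, 0 < w e ∧ w e < 1) (x : V) (Y : Set V) (S : Finset V)
    (hxS : x ∈ S) (o v : V) (hvS : v ∉ S) (hvY : v ∉ Y) (g : Set (Sym2 V) → ℝ) (hg : Monotone g)
    (hHtw : (prodBernoulli w).real ({ω : BondConfig V | ∀ a ∈ (↑S ∪ Y : Set V), ¬ (openGraph ω).Reachable v a} ∩ openConn o v) *
        (∫ ω in {ω : BondConfig V | ∀ y ∈ Y, ¬ (openGraph ω).Reachable x y},
          ((∫ η in (⋃ t ∈ S, openConn v t), g (openEdgeCluster η x)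
              ∂(prodBernoulli fun e => if (∃ z ∈ e, ∃ y ∈ Y, (openGraph ω).Reachable y z) then (0 : unitInterval) else w e)) -
            (prodBernoulli fun e => if (∃ z ∈ e, ∃ y ∈ Y, (openGraph ω).Reachable y z) then (0 : unitInterval) else w e).real
                (⋃ t ∈ S, openConn v t) *
              (∫ η, g (openEdgeCluster η x)
                ∂(prodBernoulli fun e => if (∃ z ∈ e, ∃ y ∈ Y, (openGraph ω).Reachable y z) then (0 : unitInterval) else w e)))
          ∂(prodBernoulli w)) ≤
      (prodBernoulli w).real {ω : BondConfig V | ∀ a ∈ (↑S ∪ Y : Set V), ¬ (openGraph ω).Reachable v a} *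
        (∫ ω in {ω : BondConfig V | ∀ y ∈ Y, ¬ (openGraph ω).Reachable x y},
          ((prodBernoulli fun e => if (∃ z ∈ e, ∃ y ∈ Y, (openGraph ω).Reachable y z) then (0 : unitInterval) else w e).real
                ({η : BondConfig V | ∀ t ∈ S, ¬ (openGraph η).Reachable v t} ∩ openConn o v) /
              (prodBernoulli fun e => if (∃ z ∈ e, ∃ y ∈ Y, (openGraph ω).Reachable y z) then (0 : unitInterval) else w e).real
                {η : BondConfig V | ∀ t ∈ S, ¬ (openGraph η).Reachable v t}) *
          ((∫ η in (⋃ t ∈ S, openConn v t), g (openEdgeCluster η x)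
              ∂(prodBernoulli fun e => if (∃ z ∈ e, ∃ y ∈ Y, (openGraph ω).Reachable y z) then (0 : unitInterval) else w e)) -
            (prodBernoulli fun e => if (∃ z ∈ e, ∃ y ∈ Y, (openGraph ω).Reachable y z) then (0 : unitInterval) else w e).real
                (⋃ t ∈ S, openConn v t) *
              (∫ η, g (openEdgeCluster η x)
                ∂(prodBernoulli fun e => if (∃ z ∈ e, ∃ y ∈ Y, (openGraph ω).Reachable y z) then (0 : unitInterval) else w e)))
          ∂(prodBernoulli w))) :
    ∫ ω in {ω : BondConfig V | ∀ y ∈ Y, ¬ (openGraph ω).Reachable x y},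
        ((∫ η in ((⋃ t ∈ S, openConn o t) ∪ openConn o v), g (openEdgeCluster η x)
            ∂(prodBernoulli fun e => if (∃ z ∈ e, ∃ y ∈ Y, (openGraph ω).Reachable y z) then (0 : unitInterval) else w e)) -
          (prodBernoulli fun e => if (∃ z ∈ e, ∃ y ∈ Y, (openGraph ω).Reachable y z) then (0 : unitInterval) else w e).real
              ((⋃ t ∈ S, openConn o t) ∪ openConn o v) *
            (∫ η, g (openEdgeCluster η x)
              ∂(prodBernoulli fun e => if (∃ z ∈ e, ∃ y ∈ Y, (openGraph ω).Reachable y z) then (0 : unitInterval) else w e)))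
      ∂(prodBernoulli w) ≤
    ∫ ω in {ω : BondConfig V | ∀ y ∈ Y, ¬ (openGraph ω).Reachable x y},
      (((∫ η in (⋃ t ∈ S, openConn o t), g (openEdgeCluster η x)
            ∂(prodBernoulli fun e => if (∃ z ∈ e, ∃ y ∈ Y, (openGraph ω).Reachable y z) then (0 : unitInterval) else w e)) -
          (prodBernoulli fun e => if (∃ z ∈ e, ∃ y ∈ Y, (openGraph ω).Reachable y z) then (0 : unitInterval) else w e).real
              (⋃ t ∈ S, openConn o t) *
            (∫ η, g (openEdgeCluster η x)
              ∂(prodBernoulli fun e => if (∃ z ∈ e, ∃ y ∈ Y, (openGraph ω).Reachable y z) then (0 : unitInterval) else w e))) -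
        obsConst w o v (↑S ∪ Y) *
          ((∫ η in (⋃ t ∈ S, openConn v t), g (openEdgeCluster η x)
              ∂(prodBernoulli fun e => if (∃ z ∈ e, ∃ y ∈ Y, (openGraph ω).Reachable y z) then (0 : unitInterval) else w e)) -
            (prodBernoulli fun e => if (∃ z ∈ e, ∃ y ∈ Y, (openGraph ω).Reachable y z) then (0 : unitInterval) else w e).real
                (⋃ t ∈ S, openConn v t) *
              (∫ η, g (openEdgeCluster η x)
                ∂(prodBernoulli fun e => if (∃ z ∈ e, ∃ y ∈ Y, (openGraph ω).Reachable y z) then (0 : unitInterval) else w e))))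
      ∂(prodBernoulli w) := by
  set μ := prodBernoulli w with hμ
  -- world weights and world quantities
  set wW : BondConfig V → Sym2 V → unitInterval := fun ω e =>
    if (∃ z ∈ e, ∃ y ∈ Y, (openGraph ω).Reachable y z) then (0 : unitInterval) else w e with hwW
  set CovO : BondConfig V → ℝ := fun ω =>
    (∫ η in (⋃ t ∈ S, openConn o t), g (openEdgeCluster η x) ∂(prodBernoulli (wW ω))) -
      (prodBernoulli (wW ω)).real (⋃ t ∈ S, openConn o t) * ∫ η, g (openEdgeCluster η x) ∂(prodBernoulli (wW ω)) with hCovO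
  set CovV : BondConfig V → ℝ := fun ω =>
    (∫ η in (⋃ t ∈ S, openConn v t), g (openEdgeCluster η x) ∂(prodBernoulli (wW ω))) -
      (prodBernoulli (wW ω)).real (⋃ t ∈ S, openConn v t) * ∫ η, g (openEdgeCluster η x) ∂(prodBernoulli (wW ω)) with hCovV
  set CovU : BondConfig V → ℝ := fun ω =>
    (∫ η in ((⋃ t ∈ S, openConn o t) ∪ openConn o v), g (openEdgeCluster η x) ∂(prodBernoulli (wW ω))) -
      (prodBernoulli (wW ω)).real ((⋃ t ∈ S, openConn o t) ∪ openConn o v) * ∫ η, g (openEdgeCluster η x) ∂(prodBernoulli (wW ω))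
    with hCovU
  set pW : BondConfig V → ℝ := fun ω =>
    (prodBernoulli (wW ω)).real ({η : BondConfig V | ∀ t ∈ S, ¬ (openGraph η).Reachable v t} ∩ openConn o v) /
      (prodBernoulli (wW ω)).real {η : BondConfig V | ∀ t ∈ S, ¬ (openGraph η).Reachable v t} with hpW
  set M : ℝ := μ.real {ω : BondConfig V | ∀ a ∈ (↑S ∪ Y : Set V), ¬ (openGraph ω).Reachable v a} with hM
  set E : ℝ := μ.real ({ω : BondConfig V | ∀ a ∈ (↑S ∪ Y : Set V), ¬ (openGraph ω).Reachable v a} ∩ openConn o v) with hE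
  set Dset : Set (BondConfig V) := {ω : BondConfig V | ∀ y ∈ Y, ¬ (openGraph ω).Reachable x y} with hDset
  change E * ∫ ω in Dset, CovV ω ∂μ ≤ M * ∫ ω in Dset, pW ω * CovV ω ∂μ at hHtw
  change ∫ ω in Dset, CovU ω ∂μ ≤ ∫ ω in Dset, (CovO ω - obsConst w o v (↑S ∪ Y) * CovV ω) ∂μ
  have hmeas : ∀ T : Set (BondConfig V), MeasurableSet T := fun _ => MeasurableSet.of_discrete
  have hint : ∀ (k : BondConfig V → ℝ) (T : Set (BondConfig V)), IntegrableOn k T μ :=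
    fun k T => (Integrable.of_finite).integrableOn
  -- positivity of the global conditioning probability and the observers' constant
  have hMpos : 0 < M := by
    refine prodBernoulli_real_pos_of_nonempty hw ⟨∅, fun a ha hreach => ?_⟩
    have hbot : openGraph (∅ : BondConfig V) = ⊥ := by
      unfold openGraph; exact SimpleGraph.fromEdgeSet_empty
    rw [hbot, SimpleGraph.reachable_bot] at hreach
    subst hreach
    rcases ha with ha | ha
    · exact hvS (Finset.mem_coe.1 ha)
    · exact hvY ha
  have hobs : obsConst w o v (↑S ∪ Y) = E / M := by unfold obsConst; rfl
  -- (K6) with the Harris term, in each world: `pW ω · CovV ω + CovU ω ≤ CovO ω`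
  have hworld : ∀ ω : BondConfig V, pW ω * CovV ω + CovU ω ≤ CovO ω := by
    intro ω
    have hK6 := covTransfer_relaySet_edge_harrisFloor (wW ω) S o v x hxS g hg
    have hlt : ∀ e, wW ω e < 1 := by
      intro e
      simp only [hwW]
      split_ifs
      · exact zero_lt_one
      · exact (hw e).2
    have hMWpos : 0 < (prodBernoulli (wW ω)).real {η : BondConfig V | ∀ t ∈ S, ¬ (openGraph η).Reachable v t} := by
      refine prodBernoulli_real_pos_of_empty_mem (wW ω) hlt (fun t ht hreach => ?_)
      have hbot : openGraph (∅ : BondConfig V) = ⊥ := by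
        unfold openGraph; exact SimpleGraph.fromEdgeSet_empty
      rw [hbot, SimpleGraph.reachable_bot] at hreach
      exact hvS (hreach ▸ ht)
    set MW := (prodBernoulli (wW ω)).real {η : BondConfig V | ∀ t ∈ S, ¬ (openGraph η).Reachable v t} with hMW
    set EW := (prodBernoulli (wW ω)).real ({η : BondConfig V | ∀ t ∈ S, ¬ (openGraph η).Reachable v t} ∩ openConn o v) with hEW
    change EW * CovV ω + MW * CovU ω ≤ MW * CovO ω at hK6
    have hp : pW ω = EW / MW := rfl
    rw [hp]
    have h1 : EW / MW * CovV ω + CovU ω = (EW * CovV ω + MW * CovU ω) / MW := by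
      field_simp
    rw [h1, div_le_iff₀ hMWpos]
    linarith [hK6, mul_comm MW (CovO ω)]
  -- integrate the world inequality over `Dset`
  have hI1 : ∫ ω in Dset, (pW ω * CovV ω + CovU ω) ∂μ ≤ ∫ ω in Dset, CovO ω ∂μ :=
    setIntegral_mono_on (hint _ _) (hint _ _) (hmeas Dset) fun ω _ => hworld ω
  rw [integral_add (hint _ _) (hint _ _)] at hI1
  -- (Htw) divided by `M`
  have hI2 : E / M * ∫ ω in Dset, CovV ω ∂μ ≤ ∫ ω in Dset, pW ω * CovV ω ∂μ := by
    rw [div_mul_eq_mul_div, div_le_iff₀ hMpos]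
    linarith [hHtw, mul_comm M (∫ ω in Dset, pW ω * CovV ω ∂μ)]
  have hR : ∫ ω in Dset, (CovO ω - obsConst w o v (↑S ∪ Y) * CovV ω) ∂μ
      = (∫ ω in Dset, CovO ω ∂μ) - E / M * ∫ ω in Dset, CovV ω ∂μ := by
    rw [integral_sub (hint _ _) (hint _ _), integral_const_mul, hobs]
  rw [hR]
  linarith [hI1, hI2]

/-- **LEMMA H with the world Harris terms kept, UNCONDITIONAL** (`hHtw` discharged by `CSH.htw_world`): for non-degenerate weights, `x ∈ S`,
`v ∉ S ∪ Y`, `g` monotone `≥ 0`: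
`∫_{x↮Y} Cov_{w^ω}(g(𝒞_x), 1{o↔S ∪ {v}}) dμ ≤ ∫_{x↮Y} [Cov_{w^ω}(g,1{o↔S}) − μ(o↔v | v↮S∪Y)·Cov_{w^ω}(g,1{v↔S})] dμ`.
[cite: VandenbergHaggstromKahn2005, Thm. 1.1 (pp. 3–5), Thm. 1.4 (p. 7)] [cite: Gladkov2024, Thm. 3.2 (p. 4)] -/
theorem worldHarris_le_hpart (w : Sym2 V → unitInterval) (hw : ∀ e, 0 < w e ∧ w e < 1) (x : V) (Y : Set V) (S : Finset V)
    (hxS : x ∈ S) (o v : V) (hvS : v ∉ S) (hvY : v ∉ Y) (g : Set (Sym2 V) → ℝ) (hg : Monotone g) (hg0 : ∀ C, 0 ≤ g C) :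
    ∫ ω in {ω : BondConfig V | ∀ y ∈ Y, ¬ (openGraph ω).Reachable x y},
        ((∫ η in ((⋃ t ∈ S, openConn o t) ∪ openConn o v), g (openEdgeCluster η x)
            ∂(prodBernoulli fun e => if (∃ z ∈ e, ∃ y ∈ Y, (openGraph ω).Reachable y z) then (0 : unitInterval) else w e)) -
          (prodBernoulli fun e => if (∃ z ∈ e, ∃ y ∈ Y, (openGraph ω).Reachable y z) then (0 : unitInterval) else w e).real
              ((⋃ t ∈ S, openConn o t) ∪ openConn o v) *
            (∫ η, g (openEdgeCluster η x)
              ∂(prodBernoulli fun e => if (∃ z ∈ e, ∃ y ∈ Y, (openGraph ω).Reachable y z) then (0 : unitInterval) else w e)))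
      ∂(prodBernoulli w) ≤
    ∫ ω in {ω : BondConfig V | ∀ y ∈ Y, ¬ (openGraph ω).Reachable x y},
      (((∫ η in (⋃ t ∈ S, openConn o t), g (openEdgeCluster η x)
            ∂(prodBernoulli fun e => if (∃ z ∈ e, ∃ y ∈ Y, (openGraph ω).Reachable y z) then (0 : unitInterval) else w e)) -
          (prodBernoulli fun e => if (∃ z ∈ e, ∃ y ∈ Y, (openGraph ω).Reachable y z) then (0 : unitInterval) else w e).real
              (⋃ t ∈ S, openConn o t) *
            (∫ η, g (openEdgeCluster η x)
              ∂(prodBernoulli fun e => if (∃ z ∈ e, ∃ y ∈ Y, (openGraph ω).Reachable y z) then (0 : unitInterval) else w e))) -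
        obsConst w o v (↑S ∪ Y) *
          ((∫ η in (⋃ t ∈ S, openConn v t), g (openEdgeCluster η x)
              ∂(prodBernoulli fun e => if (∃ z ∈ e, ∃ y ∈ Y, (openGraph ω).Reachable y z) then (0 : unitInterval) else w e)) -
            (prodBernoulli fun e => if (∃ z ∈ e, ∃ y ∈ Y, (openGraph ω).Reachable y z) then (0 : unitInterval) else w e).real
                (⋃ t ∈ S, openConn v t) *
              (∫ η, g (openEdgeCluster η x)
                ∂(prodBernoulli fun e => if (∃ z ∈ e, ∃ y ∈ Y, (openGraph ω).Reachable y z) then (0 : unitInterval) else w e))))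
      ∂(prodBernoulli w) :=
  worldHarris_le_hpart_of_htw w hw x Y S hxS o v hvS hvY g hg (htw_world w x Y S hxS o v hvS g hg hg0)

end Summit.CriticalPhenomena.PercolationContinuityZ3.Theorems.CSH

end
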